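import Summits.BirchSwinnertonDyer.BirchSwinnertonDyer.Theses.EisensteinPrimes
import Summits.BirchSwinnertonDyer.Rank1Residual.X2.TamagawaSqueeze
import Summits.BirchSwinnertonDyer.Rank1Residual.X2.RankOneHeegnerExact
import Summits.BirchSwinnertonDyer.Rank1Residual.X2.IsogenyClassStability
import Summits.BirchSwinnertonDyer.Rank1Residual.X2.HidaLimitSingleLevel
import Summits.BirchSwinnertonDyer.BirchSwinnertonDyer.Theorems.EisensteinPrimesMazurMCOnCellBLocate
import Summits.BirchSwinnertonDyer.BirchSwinnertonDyer.Theorems.EisensteinPrimesMazurMCOnCellBMuPartTight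
import Summits.BirchSwinnertonDyer.BirchSwinnertonDyer.Theorems.EisensteinPrimesMazurMCOnCellBMuPartTightParity
import Summits.BirchSwinnertonDyer.BirchSwinnertonDyer.Theorems.EisensteinPrimesX2AnalyticMuBound
import Literature.Barriers.BirchSwinnertonDyer.EisensteinMuConjecture
import Literature.NumberTheory.EllipticCurves.TateCurve.NumberFieldUniformization
import Literature.NumberTheory.EllipticCurves.TateCurve.NumberFieldUniformizationTwisted
import HarnessLib

/-!
# Crux `MazurMCOnCellB` (stmt-BirchSwinnertonDyer-19033) — line `deepmember` (ideator bsd-idea-12 g4, lens=embed,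
# 2026-08-28; PUBLISHED, NOT REGISTERED — W-79: the skeleton of record stays `Lines/mudescent.lean` v4 until a LEAD switches):
# the NON-SPLIT half by ONE DEEP CONGRUENT MEMBER of the Hida family (cell road D / R9 through the single-level door
# p532265), the SPLIT half kept in `mudescent` v4's (μ, λ) currency

ANSWERS the LEAD's standing request (`Lines/mudescent-lead-verdict-g4.md` §4 (a), `…-g5.md` §3: «no further LEAD
regen on `mudescent` until an ideator registers the non-split line (R9 / road D, PRE-conditional) as a skeleton
whose conclusion is v4's stubs ∩ non-split»). BSD is proved for no curve by this file; nothing is booked; every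
stub below is OPEN or FACT-grade exactly as labelled; no main conjecture is proved here.
v1.2 (2026-08-28, g5; DOCSTRING-ONLY, statements byte-identical to v1.1 4784dd46…): citation locators
corrected per bsd-eis-lit g43 (T160) nit 162a — the `p = 3` / Ohta passages of Burungale–Skinner–Tian–Wan
arXiv:2409.01350v2 are §3.2 (after the Λ-adic Eichler–Shimura theorem) and §5.1 Remark, not §§4–5; «[SV-S-Ohta]» =
Sangiovanni Vincentelli–Skinner (preprint) + Cais, Compos. Math. 154 (2018), not «Sprung–Venkat–Sweeting».

THE LINE. Crux 3 = row A10 (X2b: `r_an = 0`, odd MULTIPLICATIVE Eisenstein `p`, `¬ GVPar`). As in `mudescent`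
v4, DESCEND first (`stub_locate`, LANDED p443911) to the étale end `W₀` of the isogeny class (no ramified-odd
rational `p`-line) and ASCEND at the end (`X2.mazurMainConjectureAt_of_isIsogenous`); at `(W₀, p)` split by the
SIGN of the multiplicative reduction:
* NON-SPLIT `p` (stubs 3a/3b, THE NEW CUT): the tree's SINGLE-LEVEL DOOR
  `X2.mazurMainConjectureAt_of_singleLevelMember_of_not_split` (p532265; Castella–Grossi–Skinner 2025 §7.2 Step 3
  (arXiv v1: Thm. 6.1.3) «key congruence», Skinner 2016 §3.1) turns Kato–Wuthrich (`char X ∣ (f_E)`, stub 1) + Greenberg's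
  Prop. 4.15 (ii) (`Fitt X = char X`, stub 1b) + `f_E ≠ 0` (KERNEL at `r_an = 0`:
  `…X2AnalyticMuBound.ne_zero_of_iwasawaToPowerSeries_eq_of_analyticRank_eq_zero`) + ONE
  `X2.CongruentMemberData p X(E₀/ℚ_∞) f_E m` at SOME depth `m > μ(f_E)` into `X2.MazurMainConjectureAt W₀ p`.
  The member datum is what the stubs ask for; its CONSTRUCTION is the cell's ROAD D (cgshw MEMO-21 §§3–6):
  Mazur–Greenberg's main conjecture for ONE good-ordinary member `g_k` (weight `k ≡ 2 mod (p−1)p^{m−1}`,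
  level `N′ = N/p`, `k` deep enough) of the Hida family through `f_E`, by Castella–Grossi–Skinner's own
  two-variable argument run at the p-OLD CRYSTALLINE point `g_k` — where `p ∤ N′`, so CGS Prop. 3.4.4,
  Kings–Loeffler–Zerbes' explicit reciprocity law and Kato 17.4 (1)–(2) apply INSIDE their printed scope
  (MEMO-21 T12/T14/T20; barrier `ReducibleAnticyclotomicAtBadP`, evasion (i) «change the point») —, then Hida /
  Ohta control for `congr`, the two-variable `p`-adic `L`-function for `lcongr` (family constants B1′–B4′,
  MEMO-21 §5). EXPOSURE (MEMO-21 §6 P1): PRE = {Keller–Yin arXiv:2402.12781 §§1–3 (Thm. 3.0.8 at ONE weight),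
  Burungale–Skinner–Tian–Wan §3.2 (after the Λ-adic Eichler–Shimura theorem) and §5.1 Remark}; WORK = weight-`k` re-typesetting of CGS §3, Thm. 4.3.1, BSTW §5, and
  B1′–B4′; RIDERS `p ≥ 5`, `p ∤ φ(N′)` (GS93, BP19 §3.1, KLZ17 §7.2, Ohta / Fukaya–Kato) — hence TWO member
  stubs: 3a in the riders' regime, 3b outside it (`p = 3` or `p ∣ φ(N′)`: CGS Theorem A's own `p = 3` status,
  BSTW v2 §3.2/§5.1: Sangiovanni Vincentelli–Skinner (preprint) + Cais 2018; MEMO-21 l.124). REACH on the N9 atlas: the 44 non-split A10 cells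
  are ALL at `p = 3`, i.e. all in stub 3b's regime (0/44 for 3a) — the crux is class-wide, the atlas is not.
* SPLIT `p` (stubs 4–5 = `mudescent` v4's stubs 3′, 4″ VERBATIM, RESTRICTED to split `W₀`): the member road is
  VOID at split `p` (CGS's «`φ|G_p ≠ 1, ω`» fails for every member, `X2.TateLineDecomposition`; KLZ Rem. 8.2.4
  cokernel; MEMO-21 §1, §§11–12), so the split half stays in the (μ, λ) currency where the per-pair certificates
  live (route T / tower budget / Mazur twin family), squeezed by the μ-TOLERANT PARITY route T
  (`…MuPartTightParity.mazurMainConjectureAt_of_muPart_of_lambdaCountParity`, p611137) exactly as in v4.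
CONCLUSION = v4's stubs ∩ non-split: §3 below derives, SORRY-FREE from the stubs, `mudescent`'s `stub_muPart_offLocus`
and `stub_lambdaCountWeak_offLocus` restricted to non-split `W₀` (per-pair converses
`…MuPartTight.muPart_of_mazurMainConjectureAt` / `.exists_lambdaCount_of_mazurMainConjectureAt_of_analyticRank_eq_zero`),
so this line's non-split stubs DOMINATE v4's non-split halves and its split stubs ARE v4's split halves: switching
costs the LEAD nothing on the split side.

HONEST LABELS. (1) TRUTH-VALUE: the typed member stub is EQUIVALENT to crux 3 ∩ non-split at the étale ends given
stubs 1/1b (`X2.CongruentMemberData.self`: if `Fitt X = (f_E)` then `N := X` is a member at every depth; conversely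
the door) — its CONTENT is the ROAD, the freedom to take for `N` the Selmer dual of a good-ordinary member, exactly
as the tree's docstring of `X2.HigherWeightCongruencesAt` says; road D's internal cut (T1–T22, B1′–B4′) is not
typable today (no Λ-adic forms `𝕀`, no branch `𝐓`, no weight-`k` Selmer duals in the tree; MEMO-21 §2), so the
non-split half is ONE stub per regime, not five. (2) NOVELTY: none claimed — mechanism = the cell's road D / R9
(cgshw MEMO-1 … MEMO-21) on the kernel door p532265; the embed-lens reading (program-embedding: crux 3 ∩ non-split
is the weight-2 point of «the main conjecture is locally constant on the étale branch of the Eisenstein Hida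
family», MEMO-21 §3) adds no mechanism. (3) TRANSFER C⁺ = MC for ONE deep good-ordinary member; WHY EASIER: at the
member `p ∤ N′` (crystalline), so the printed Euler-system machine applies in scope, whereas at `f_E` itself
(`p ‖ N`, p-new) the explicit reciprocity law is outside KLZ17's literal scope (R9's bookkeeping B1/B3/B5–B9).
(4) `Disproof.lean` for this crux: none (`ledger crux ls`, 2026-08-28T09:5xZ); negatives index: no entry bears on
a member / door statement. (5) Sibling lines: `mudescent` v4 (of record; sign-free (μ, λ) squeeze at the étale end),
`bysign` (k5-c3 g0; excluded middle on the sign, whole halves as stubs). This line = `bysign`'s case split with the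
non-split half CUT at the door and the split half CUT as v4 cuts it.

v1.3 (bsd-idea-12 g6, 2026-08-28) = idea-crit-14 g1 VERDICT #25 (10:46:42Z, PASS-WITH-PRICE on v1.2) PRICES PAID —
docstrings and cards only, NO statement change (the critic's BC7 2/2 CLEAN and mine 4/4 stand). (P-a) TRUTH VALUE /
ENTRY POINT, stated as the critic asks and to travel with the line into any L0 table: OPEN CONTENT OF THE NON-SPLIT HALF
= ROAD D ENTIRE, PRE + WORK, ONE stub per regime; size XL; a prover has NO kernel-level entry point below road D, whose
internal steps (MC for ONE good-ordinary member `g_k` at the crystalline point — CGS §§2–4/7 re-run at weight `k`, KY24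
Thm. 3.0.8 PRE, BSTW §5 PRE; Hida/Ohta control; GS93/Kitagawa two-variable `L_p` + family constants B1′–B4′) are
untypable today; the line's value is that the door's INPUT OBJECT is the would-be registered target instead of
«MC ∩ non-split». FIRST TYPABLE SUB-OBJECT of road D that would cut stub 3a below the crux (critic's reading, AGREED —
see the card for the precise form): the member's `lcongr` clause ALONE — `(L_{g_k}) + (p^m) = (f_E) + (p^m)` for the
GS93 two-variable `p`-adic `L`-function restricted to the weight-`k` fibre of the étale branch, a statement about
`p`-adic `L`-FUNCTIONS only (no Selmer dual of `g_k`), = MEMO-20 §2 «`lcongr` at depth `m − e − c`» (local constancy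
of `p`-contents on the branch, Delbourgo–Kitagawa Prop. 4.10 (ii) localised) — a D-request
«`X2.TwoVariableLpFibreCongruence`» for the pen (it needs ONE new predicate: the weight-`k` MTT interpolation property,
with the branch period normalisation carried as DATA); the other two fields (`congr`: Hida/Ohta control of the big
ordinary Selmer dual; `fitt`: (HW-A¹) = Mazur–Greenberg MC for `g_k`, OPEN) stay untypable — so the cut isolates the
publishable third of 3a and leaves (HW-A¹) as the open remainder: it marks where the first cut falls, not a smaller
bill. (P-b) REGIME POPULATION (numbers to quote with the cut): on the N9 atlas ALL 44 non-split row-A10 cells are at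
`p = 3`, i.e. in stub 3b (the regime with the EXTRA preprint exposure: BSTW v2 §3.2/§5.1 Remark → Sangiovanni
Vincentelli–Skinner PRE + Cais 2018, GS/BP at 3, non-Gorenstein Eisenstein Hecke algebra when `p ∣ φ(N′)`), and 0/44
in stub 3a (the regime where print is closest). Director number for row A10 from this line: non-split 44 cells → 3b
(PRE + WORK + `p = 3` riders, no cell closed); split 83 cells → stubs 4/5 (OPEN class-wide, CERT per pair as in v4);
cells closed by the line: 0. The crux is class-wide; the atlas is not — both sentences stand. (P-c) ✓ (stub 4 = v4
stub 3′ verbatim + one hypothesis; stub 5 = v4 stub 4″'s conclusion ∩ split). (P-d) the INTENDED WITNESS is now in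
stub 3a's docstring: structure depth `m = μ(f_E) + 1`, from the member of weight-depth `m₀ = μ(f_E) + 1 + e + c`
(MEMO-21 §3; congruences at depth `m₀ − e − c`). ORPHANS BY DESIGN: §3's `muPart_offLocus_nonsplit` /
`lambdaCountWeak_offLocus_nonsplit` are DOCUMENTATION (the domination certificates over v4's non-split halves), not in
`MazurMCOnCellB_of`'s cone — a registration lint should read them as such. Mazur's MC is proved for no curve here; BSD
is not proved; no cell closes.
-/

-- `Summit.BirchSwinnertonDyer.BirchSwinnertonDyer.…`: the summit and its single sub-problem share a name (D-0017 layout).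
set_option linter.dupNamespace false
set_option autoImplicit false

namespace Summit.BirchSwinnertonDyer.BirchSwinnertonDyer.Cruxes.MazurMCOnCellB.Deepmember

open scoped MatrixGroups ModularForm
open WeierstrassCurve CongruenceSubgroup
open Literature.NumberTheory.EllipticCurves Literature.NumberTheory.EllipticCurves.Rank1Residual
  Literature.NumberTheory.EllipticCurves.ModularForms
open Literature.Barriers.BirchSwinnertonDyer (HasRamifiedOddLineAt)
open Summit.BirchSwinnertonDyer.Rank1Residual.X1.MuLambda (mu)
open Summit.BirchSwinnertonDyer.Rank1Residual
open Summit.BirchSwinnertonDyer.BirchSwinnertonDyer.Theses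

/-! ## §1. The stubs -/

/-- **Stub 1 — the PUBLISHED inputs** (FACT-grade; VERBATIM the route's support item
`EisensteinPrimes.PublishedInputs` = stmt-BirchSwinnertonDyer-19037, as in `mudescent` v4: Cassels, modularity
(parametrisation, newform), Gross–Zagier–Kolyvagin, Wuthrich 2014 Thm. 16, Stein–Wuthrich 2013 Thm. 6.1 with the
canonical multiplicative heights, Greenberg–Stevens 1993 are the conjuncts consumed). Cite-only; carried exactly as
the route's `closes` carries it. [cite: Wuthrich2014, Thm. 16 (p. 397)] [cite: SteinWuthrich2013, Thm. 6.1]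
[cite: GreenbergStevens1993, (0.3)/Thm. 7.1 (p ≥ 5)] -/
theorem stub_publishedInputs : EisensteinPrimes.PublishedInputs := by
  sorry

/-- **Stub 1b — Greenberg LNM 1716 Props. 3.10 and 4.15 (ii) (FACT-grade, cite-only)**: `corank Sel ≡ λ (mod 2)`
(the parity input of route T's parity form, split half; = `mudescent` v4 stub 1b) AND «`X(E/ℚ_∞)` has no nonzero
finite `Λ`-submodule at an ordinary or multiplicative `p`» (the door's `Fitt X = char X`, non-split half). Neither
is a conjunct of `EisensteinPrimes.PublishedInputs`; both are the tree's named facts (no `_holds`).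
[cite: GreenbergLNM1716, Prop. 3.10 (end of §3) and Prop. 4.15 (ii)] -/
theorem stub_greenbergFacts :
    Greenberg1999.prop310_selmerCorank_mod_two_eq_lambdaInvariant ∧
      Greenberg1999.prop415ii_noFiniteSubmodule_of_ordinary_or_multiplicative := by
  sorry

-- Stub 2 `stub_locate` (DESCEND) LANDED: `Theorems/EisensteinPrimesMazurMCOnCellBLocate.lean` (p443911) — by name below.

/-- **Stub 3a — ONE DEEP CONGRUENT MEMBER at a NON-SPLIT étale end, riders' regime `p ≥ 5`, `p ∤ φ(N/p)`**
(road D's output in the door's currency; OPEN — PRE + WORK, MEMO-21 §6 P1). For every X2b pair `(W₀, p)` off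
the barrier locus with NON-split multiplicative reduction, `5 ≤ p` and `p ∤ φ(N_{W₀}/p)`, and for the door's data
(cyclotomic `κ, γ`; a newform `f` of `W₀`; a dual datum `D` of `Sel_{p^∞}(W₀/ℚ_∞)`; a Néron-normalising `ϖ`;
THE non-split Mazur–Tate–Teitelbaum function `L`; any integral lift `fE`, `ι(fE) = ϖ·L`): SOME depth
`m > μ(fE)` carries an `X2.CongruentMemberData p D.X fE m` — a finite `Λ`-module `N` with `X/p^m ≅ N/p^m`
(`congr`: Hida/Ohta control at the weight-`k` member, `k ≡ 2 mod (p−1)p^{m′−1}`), `Fitt_Λ N = (L_N)` (`fitt`: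
the MEMBER's main conjecture — CGS §§2–4, 7 run at the crystalline point `g_k`, KY24 Thm. 3.0.8 at one weight,
BSTW §§4–5; the p = 3 reservations are BSTW §3.2 / §5.1 Remark) and `(L_N) + (p^m) = (fE) + (p^m)` (`lcongr`: GS93/Kitagawa two-variable `L_p` + the family
constants B1′–B4′). `fE ≠ 0` is NOT asked (kernel theorem at `r_an = 0`). Why it might fail: KY24 §3 or BSTW §5
may not survive refereeing at weight `k`; B1′–B4′ (unit constancy of the Coleman / period normalisation along the
étale branch) is memo-level. INTENDED WITNESS (VERDICT #25 P-d; MEMO-21 §3 with MEMO-9 E3–E4, MEMO-20 §2): the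
structure's depth is `m = μ(fE) + 1`, realised by the member `g_k = 𝕀(P_k)` of WEIGHT-depth `m₀ := μ(fE) + 1 + e + c`
(`k ≡ 2 mod (p−1)p^{m₀−1}`, `k > 2`), where `e` is the radius exponent of the étale branch `𝒪⟨S′⟩` of the Hida family
at `P₂ = f_E` and `c` the `p`-content of the branch eigensymbols `Φ^±` at `P₂`: its congruences (`congr`, `lcongr`)
hold at depth `m₀ − e − c = μ(fE) + 1 > μ(fE)`, which is all the door needs. The `∃ m` is stated for robustness, but a
prover should NOT look for structure at larger `m`: road D gives none beyond `m₀ − e − c`.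
[cite: CastellaGrossiSkinner2025, Thm. A (= Thm. 7.1.1), Prop. 3.4.4, Thm. 4.3.1, §7.2 Step 3 (arXiv v1: Thm. 6.1.3)] [cite: KellerYin2024, §§1–3, Thm. 3.0.8 (PRE)]
[cite: KingsLoefflerZerbes2017, Thm. B and §7.2] [cite: GreenbergStevens1993, §§5–6] [cite: Skinner2016PacificMC, §3.1 (p. 192)]
[cite: BellaichePollack2019, §3.1] -/
theorem stub_deepMember_offLocus_nonsplit :
    ∀ (W₀ : WeierstrassCurve ℚ) [W₀.IsElliptic] [W₀.IsGloballyMinimal] (p : ℕ) [Fact p.Prime],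
      X2.CellB W₀ p → ¬ HasRamifiedOddLineAt W₀ p → ¬ W₀.HasSplitMultiplicativeReductionAtPrime p →
      5 ≤ p → ¬ (p ∣ Nat.totient (W₀.conductorNorm ℤ / p)) →
      ∀ (κ : ZpExtension ℚ p) (γ : Field.absoluteGaloisGroup ℚ),
        κ.IsCyclotomic → κ.IsTopGenerator γ → IsCyclotomicVariable p γ →
        ∀ {N : ℕ} [NeZero N] (f : CuspForm (Gamma0 N) 2), IsNewformOf W₀ f →
        ∀ (D : W₀.SelmerDualData κ γ) (ϖ : ℚ), (ϖ : ℝ) * W₀.realPeriodRat = plusPeriod f →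
        ∀ (L : PowerSeries ℚ_[p]), IsMultPAdicLFunctionOf f p (-1) L →
        ∀ (fE : IwasawaAlgebra p), iwasawaToPowerSeries p fE = PowerSeries.C ((ϖ : ℚ) : ℚ_[p]) * L →
          ∃ m : ℕ, mu fE < m ∧ Nonempty (X2.CongruentMemberData p D.X fE m) := by
  sorry

/-- **Stub 3b — the same member datum OUTSIDE the riders' regime: `p = 3` or `p ∣ φ(N/p)`** (road D plus the
`p = 3` / nebentype riders; OPEN — PRE + WORK + the extra `p = 3` inputs: CGS Theorem A's own `p = 3` status via
BSTW v2 §3.2 and §5.1 Remark (Sangiovanni Vincentelli–Skinner preprint + Cais, Compos. Math. 154 (2018)), Greenberg–Stevens / Bellaïche–Pollack at `3`, MEMO-21 l.124–125).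
This is where ALL 44 non-split A10 cells of the N9 atlas sit (every one is at `p = 3`). Why it might fail: at `p = 3`
the Λ-adic modular-symbol / Ohta inputs carry unlifted hypotheses and the anticyclotomic Kolyvagin input rests on two
further preprints; with `p ∣ φ(N′)` the Eisenstein component of the Hecke algebra need not be Gorenstein / monogenic
(BP19 §3.1), which B1′–B4′ use.
[cite: CastellaGrossiSkinner2025, Thm. A (= Thm. 7.1.1, stated for p > 2) and §7 (arXiv v1: §6)]
[cite: BurungaleSkinnerTianWan2024, §3.2 (after the Λ-adic Eichler–Shimura theorem) and §5.1 Remark (PRE; source of the p = 3 reservations, not CGS Thm. A)] [cite: KellerYin2024, §§1–3 (PRE)]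
[cite: BellaichePollack2019, §3.1] [cite: GreenbergStevens1993, §§5–6] -/
theorem stub_deepMember_offLocus_nonsplit_rider :
    ∀ (W₀ : WeierstrassCurve ℚ) [W₀.IsElliptic] [W₀.IsGloballyMinimal] (p : ℕ) [Fact p.Prime],
      X2.CellB W₀ p → ¬ HasRamifiedOddLineAt W₀ p → ¬ W₀.HasSplitMultiplicativeReductionAtPrime p →
      (p = 3 ∨ p ∣ Nat.totient (W₀.conductorNorm ℤ / p)) →
      ∀ (κ : ZpExtension ℚ p) (γ : Field.absoluteGaloisGroup ℚ),
        κ.IsCyclotomic → κ.IsTopGenerator γ → IsCyclotomicVariable p γ →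
        ∀ {N : ℕ} [NeZero N] (f : CuspForm (Gamma0 N) 2), IsNewformOf W₀ f →
        ∀ (D : W₀.SelmerDualData κ γ) (ϖ : ℚ), (ϖ : ℝ) * W₀.realPeriodRat = plusPeriod f →
        ∀ (L : PowerSeries ℚ_[p]), IsMultPAdicLFunctionOf f p (-1) L →
        ∀ (fE : IwasawaAlgebra p), iwasawaToPowerSeries p fE = PowerSeries.C ((ϖ : ℚ) : ℚ_[p]) * L →
          ∃ m : ℕ, mu fE < m ∧ Nonempty (X2.CongruentMemberData p D.X fE m) := by
  sorry

/-- **Stub 4 — `mudescent` v4's stub 3′ (THE μ-PART OFF THE LOCUS, `μ_an ≤ μ_alg`) RESTRICTED TO SPLIT `p`**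
(OPEN class-wide on the 83 split A10 cells; VERBATIM v4's signature with the one extra hypothesis
`W₀.HasSplitMultiplicativeReductionAtPrime p`; per pair = the census certificate `X2.AnalyticMuLE W₀ p 0`; print
locator of the open question: Vatsal 2005 Conj. 1.14 (2) / Thm. 1.16 sharpness for `χ = 𝟙`, LEAD g5 §2). The member
road is VOID here (MEMO-21 §§11–12), which is why this half keeps v4's currency.
[cite: Stevens1989, Conj. IV (4.5), Cor. 4.13, Rem. 4.14] [cite: GreenbergVatsal2000, §1 p. 15 and p. 4–5]
[cite: Vatsal2005Multiplicative, Conj. 1.14 and Thm. 1.16 (p. 10–11)] [cite: Wuthrich2014, Thm. 16 (p. 397)] -/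
theorem stub_muPart_offLocus_split :
    ∀ (W₀ : WeierstrassCurve ℚ) [W₀.IsElliptic] [W₀.IsGloballyMinimal] (p : ℕ) [Fact p.Prime],
      X2.CellB W₀ p → ¬ HasRamifiedOddLineAt W₀ p → W₀.HasSplitMultiplicativeReductionAtPrime p →
      ∀ (κ : ZpExtension ℚ p) (γ : Field.absoluteGaloisGroup ℚ),
        κ.IsCyclotomic → κ.IsTopGenerator γ → IsCyclotomicVariable p γ →
        ∀ {N : ℕ} [NeZero N] (f : CuspForm (Gamma0 N) 2), IsNewformOf W₀ f →
        ∀ (ϖ : ℚ), (ϖ : ℝ) * W₀.realPeriodRat = plusPeriod f →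
        ∀ (L : PowerSeries ℚ_[p]),
          (W₀.HasSplitMultiplicativeReductionAtPrime p → IsSplitMultPAdicLFunctionOf f p L) →
          (¬ W₀.HasSplitMultiplicativeReductionAtPrime p → IsMultPAdicLFunctionOf f p (-1) L) →
        ∀ (D : W₀.SelmerDualData κ γ) (g G : IwasawaAlgebra p), D.charIdeal = Ideal.span {g} →
          iwasawaToPowerSeries p G = PowerSeries.C ((ϖ : ℚ) : ℚ_[p]) * L → mu G ≤ mu g := by
  sorry

/-- **Stub 5 — `mudescent` v4's stub 4″ (THE λ-COUNT OFF THE LOCUS WITH PARITY SLACK) RESTRICTED TO SPLIT `p`**: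
`λ_an(W₀) ≤ λ_alg(W₀) + 2` at a split étale end (trivial zero `e = 1` + parity slack `1`; OPEN class-wide on the 83
split cells; per pair = tower budget + analytic certificate, Theorem B′ on the Mazur twin family). VERBATIM v4's
conclusion ∩ split. [cite: GreenbergVatsal2000, §2 Props. (2.4)–(2.8)] [cite: MazurTateTeitelbaum1986Invent, §I.17–I.18]
[cite: GreenbergLNM1716, Prop. 3.10, Prop. 5.10 (p. 118), p. 119] -/
theorem stub_lambdaCountWeak_offLocus_split :
    ∀ (W₀ : WeierstrassCurve ℚ) [W₀.IsElliptic] [W₀.IsGloballyMinimal] (p : ℕ) [Fact p.Prime],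
      X2.CellB W₀ p → ¬ HasRamifiedOddLineAt W₀ p → W₀.HasSplitMultiplicativeReductionAtPrime p →
        ∃ n k : ℕ, X2.AnalyticLambdaEq W₀ p n ∧ X1.TamagawaSqueeze.AlgebraicLambdaGE W₀ p k ∧ n ≤ k + 2 := by
  sorry

/-! ## §2. The non-split étale end through the door, and the composition -/

/-- **Mazur's main conjecture at a NON-SPLIT X2b étale end** from stubs 1, 1b, 3a/3b and the KERNEL: `p = 3 ∨ p ≥ 5`
for an odd prime (regime dispatch), `fE ≠ 0` at `r_an = 0` (`…X2AnalyticMuBound`), then the single-level door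
(p532265). [cite: CastellaGrossiSkinner2025, §7.2 Step 3 (arXiv v1: Thm. 6.1.3)] [cite: Wuthrich2014, Thm. 16 (p. 397)]
[cite: GreenbergLNM1716, Prop. 4.15 (ii)] -/
theorem mazurMainConjectureAt_offLocus_nonsplit (W₀ : WeierstrassCurve ℚ) [W₀.IsElliptic] [W₀.IsGloballyMinimal]
    (p : ℕ) [Fact p.Prime] (hc₀ : X2.CellB W₀ p) (hoff : ¬ HasRamifiedOddLineAt W₀ p)
    (hns : ¬ W₀.HasSplitMultiplicativeReductionAtPrime p) : X2.MazurMainConjectureAt W₀ p := by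
  have hP : EisensteinPrimes.PublishedInputs := stub_publishedInputs
  have hpar := hP.2.2.2.2.1
  have hWu := hP.2.2.2.2.2.2.2.2.2.2.2.2.2.2.1
  have hGS := hP.2.2.2.2.2.2.2.2.2.2.2.2.2.2.2.2.2.2.2
  have hp2 : p ≠ 2 := hc₀.2.1.1
  have hred₀ : ¬ W₀.HasIrreducibleModPGaloisRep p := hc₀.2.1.2.1
  have hmult₀ : W₀.HasMultiplicativeReductionAtPrime p := hc₀.2.1.2.2
  have hr₀ : W₀.analyticRank = 0 := hc₀.1
  refine X2.mazurMainConjectureAt_of_singleLevelMember_of_not_split W₀ p hWu stub_greenbergFacts.2 hp2 hmult₀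
    hns hred₀ ?_
  intro κ γ hκ hγ hγ' N _ f hf D ϖ hϖ L hL fE hfE
  refine ⟨Summit.BirchSwinnertonDyer.BirchSwinnertonDyer.Theorems.EisensteinPrimesX2AnalyticMuBound.ne_zero_of_iwasawaToPowerSeries_eq_of_analyticRank_eq_zero
      hpar hp2 (hGS W₀ p) hr₀ hf hϖ (fun hs ↦ absurd hs hns) (fun _ ↦ hL) hfE, ?_⟩
  by_cases h5 : 5 ≤ p
  · by_cases hφ : p ∣ Nat.totient (W₀.conductorNorm ℤ / p)
    · exact stub_deepMember_offLocus_nonsplit_rider W₀ p hc₀ hoff hns (Or.inr hφ) κ γ hκ hγ hγ' f hf D ϖ hϖ L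
        hL fE hfE
    · exact stub_deepMember_offLocus_nonsplit W₀ p hc₀ hoff hns h5 hφ κ γ hκ hγ hγ' f hf D ϖ hϖ L hL fE hfE
  · have h3 : p = 3 := by
      have hp : p.Prime := Fact.out
      have h2 := hp.two_le
      interval_cases p
      · exact absurd rfl hp2
      · rfl
      · exact absurd hp (by decide)
    exact stub_deepMember_offLocus_nonsplit_rider W₀ p hc₀ hoff hns (Or.inl h3) κ γ hκ hγ hγ' f hf D ϖ hϖ L hL
      fE hfE

/-- **Composition — the crux `MazurMCOnCellB` BY NAME.** Given an X2b pair `(W, p)`: DESCEND to `W₀` off the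
locus (`stub_locate`, p443911); `X2.CellB W₀ p` (`X2.cellB_iff_of_isIsogenous`, Tate uniformisation discharged);
at `(W₀, p)` by the SIGN: non-split ⇒ `mazurMainConjectureAt_offLocus_nonsplit` (door + member, stubs 3a/3b);
split ⇒ the μ-TOLERANT PARITY route T (p611137) from the μ-part (stub 4), the λ-count (stub 5), the kernel parity
`λ_an ≡ r_an + e` (`X2.analyticLambdaEq_parity`) and Greenberg's Prop. 3.10 (stub 1b), exactly as `mudescent` v4;
ASCEND along `W₀ ∼ W` (`X2.mazurMainConjectureAt_of_isIsogenous`). [cite: PerrinRiou1989Isogenie, Théorème (p. 349)]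
[cite: Wuthrich2014, Thm. 16 and Lemma 17 (p. 397)] [cite: CastellaGrossiSkinner2025, §7.2 Step 3 (arXiv v1: Thm. 6.1.3)] -/
theorem MazurMCOnCellB_of :
    Summit.BirchSwinnertonDyer.BirchSwinnertonDyer.Theses.EisensteinPrimes.MazurMCOnCellB := by
  unfold Summit.BirchSwinnertonDyer.BirchSwinnertonDyer.Theses.EisensteinPrimes.MazurMCOnCellB
  intro W _ _ p _ hc
  have hP : EisensteinPrimes.PublishedInputs := stub_publishedInputs
  have hCassels := hP.2.1
  have hpar := hP.2.2.2.2.1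
  have hnf := hP.2.2.2.2.2.1
  have hGZK := hP.2.2.2.2.2.2.2.2.2.2.1
  have hWu := hP.2.2.2.2.2.2.2.2.2.2.2.2.2.2.1
  have hJs := hP.2.2.2.2.2.2.2.2.2.2.2.2.2.2.2.1
  have hJn := hP.2.2.2.2.2.2.2.2.2.2.2.2.2.2.2.2.1
  have hHs := hP.2.2.2.2.2.2.2.2.2.2.2.2.2.2.2.2.2.1
  have hHn := hP.2.2.2.2.2.2.2.2.2.2.2.2.2.2.2.2.2.2.1
  have hGS := hP.2.2.2.2.2.2.2.2.2.2.2.2.2.2.2.2.2.2.2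
  -- DESCEND
  obtain ⟨W₀, _, _, hiso, hoff⟩ :=
    Summit.BirchSwinnertonDyer.BirchSwinnertonDyer.Theorems.EisensteinPrimesMazurMCOnCellBLocate.stub_locate W p hc
  have hc₀ : X2.CellB W₀ p :=
    (X2.cellB_iff_of_isIsogenous (p := p) TateCurve.Silverman1994_thmV53_tateUniformisation_holds
      TateCurve.Silverman1994_thmV53_corV54_tateUniformisation_holds hiso).mp hc
  have hp2 : p ≠ 2 := hc₀.2.1.1
  have hred₀ : ¬ W₀.HasIrreducibleModPGaloisRep p := hc₀.2.1.2.1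
  have hmult₀ : W₀.HasMultiplicativeReductionAtPrime p := hc₀.2.1.2.2
  have hr₀ : W₀.analyticRank = 0 := hc₀.1
  -- at the étale end, BY THE SIGN of the multiplicative reduction
  have hMC₀ : X2.MazurMainConjectureAt W₀ p := by
    by_cases hs₀ : W₀.HasSplitMultiplicativeReductionAtPrime p
    · -- SPLIT: `mudescent` v4's (μ, λ) squeeze by the μ-tolerant parity route T
      obtain ⟨m, hμm⟩ : ∃ m : ℕ, X2.AnalyticMuLE W₀ p m :=
        Summit.BirchSwinnertonDyer.BirchSwinnertonDyer.Theorems.EisensteinPrimesX2AnalyticMuBound.exists_analyticMuLE_of_analyticRank_eq_zero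
          hpar hp2 (hGS W₀ p) hr₀
      have hμ₀ := stub_muPart_offLocus_split W₀ p hc₀ hoff hs₀
      obtain ⟨n, k, hlam, halg, hkS⟩ := stub_lambdaCountWeak_offLocus_split W₀ p hc₀ hoff hs₀
      obtain ⟨-, hoddS⟩ := X2.analyticLambdaEq_parity hWu hpar W₀ p hp2 hmult₀ hred₀ hμm hlam
      exact
        Summit.BirchSwinnertonDyer.BirchSwinnertonDyer.Theorems.EisensteinPrimesMazurMCOnCellBMuPartTightParity.mazurMainConjectureAt_of_muPart_of_lambdaCountParity
          hWu stub_greenbergFacts.1 hGZK W₀ p hp2 hmult₀ hred₀ (by rw [hr₀]; exact zero_le_one) ⟨m, hμm⟩ hμ₀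
          hlam halg (fun hns ↦ absurd hs₀ hns) (fun hs ↦ ⟨hkS, hoddS hs⟩)
    · -- NON-SPLIT: one deep congruent member through the single-level door
      exact mazurMainConjectureAt_offLocus_nonsplit W₀ p hc₀ hoff hs₀
  -- ASCEND along `W₀ ∼ W`
  exact X2.mazurMainConjectureAt_of_isIsogenous hWu hJs hJn hHs hHn hGZK hnf hpar hCassels hGS
    hiso.symm_of_charZero p hp2 hmult₀ hred₀ hr₀ hMC₀

/-! ## §3. CONCLUSION = `mudescent` v4's stubs ∩ non-split (sorry-free from the stubs above) -/

/-- **v4's `stub_muPart_offLocus` ∩ NON-SPLIT, delivered by the member road**: at a non-split X2b étale end the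
μ-part `μ(ϖ·L) ≤ μ(char X)` for every datum follows from `mazurMainConjectureAt_offLocus_nonsplit` by the per-pair
converse `…MuPartTight.muPart_of_mazurMainConjectureAt`. [cite: GreenbergVatsal2000, p. 4 (after Thm. (1.2))] -/
theorem muPart_offLocus_nonsplit :
    ∀ (W₀ : WeierstrassCurve ℚ) [W₀.IsElliptic] [W₀.IsGloballyMinimal] (p : ℕ) [Fact p.Prime],
      X2.CellB W₀ p → ¬ HasRamifiedOddLineAt W₀ p → ¬ W₀.HasSplitMultiplicativeReductionAtPrime p →
      ∀ (κ : ZpExtension ℚ p) (γ : Field.absoluteGaloisGroup ℚ),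
        κ.IsCyclotomic → κ.IsTopGenerator γ → IsCyclotomicVariable p γ →
        ∀ {N : ℕ} [NeZero N] (f : CuspForm (Gamma0 N) 2), IsNewformOf W₀ f →
        ∀ (ϖ : ℚ), (ϖ : ℝ) * W₀.realPeriodRat = plusPeriod f →
        ∀ (L : PowerSeries ℚ_[p]),
          (W₀.HasSplitMultiplicativeReductionAtPrime p → IsSplitMultPAdicLFunctionOf f p L) →
          (¬ W₀.HasSplitMultiplicativeReductionAtPrime p → IsMultPAdicLFunctionOf f p (-1) L) →
        ∀ (D : W₀.SelmerDualData κ γ) (g G : IwasawaAlgebra p), D.charIdeal = Ideal.span {g} →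
          iwasawaToPowerSeries p G = PowerSeries.C ((ϖ : ℚ) : ℚ_[p]) * L → mu G ≤ mu g := by
  intro W₀ _ _ p _ hc₀ hoff hns
  exact
    Summit.BirchSwinnertonDyer.BirchSwinnertonDyer.Theorems.EisensteinPrimesMazurMCOnCellBMuPartTight.muPart_of_mazurMainConjectureAt
      (mazurMainConjectureAt_offLocus_nonsplit W₀ p hc₀ hoff hns)

/-- **v4's `stub_lambdaCountWeak_offLocus` ∩ NON-SPLIT, delivered by the member road** (even the TIGHT count
`λ_an ≤ λ_alg`, hence the weak one `≤ λ_alg + 1`): `…MuPartTight.exists_lambdaCount_of_mazurMainConjectureAt_of_analyticRank_eq_zero`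
on `mazurMainConjectureAt_offLocus_nonsplit`. [cite: GreenbergVatsal2000, p. 4 (after Thm. (1.2))] -/
theorem lambdaCountWeak_offLocus_nonsplit :
    ∀ (W₀ : WeierstrassCurve ℚ) [W₀.IsElliptic] [W₀.IsGloballyMinimal] (p : ℕ) [Fact p.Prime],
      X2.CellB W₀ p → ¬ HasRamifiedOddLineAt W₀ p → ¬ W₀.HasSplitMultiplicativeReductionAtPrime p →
        ∃ n k : ℕ, X2.AnalyticLambdaEq W₀ p n ∧ X1.TamagawaSqueeze.AlgebraicLambdaGE W₀ p k ∧ n ≤ k + 1 := by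
  intro W₀ _ _ p _ hc₀ hoff hns
  have hP : EisensteinPrimes.PublishedInputs := stub_publishedInputs
  have hpar := hP.2.2.2.2.1
  have hGS := hP.2.2.2.2.2.2.2.2.2.2.2.2.2.2.2.2.2.2.2
  obtain ⟨n, k, hlam, halg, hkN, -⟩ :=
    Summit.BirchSwinnertonDyer.BirchSwinnertonDyer.Theorems.EisensteinPrimesMazurMCOnCellBMuPartTight.exists_lambdaCount_of_mazurMainConjectureAt_of_analyticRank_eq_zero
      hpar hc₀.2.1.1 (hGS W₀ p) hc₀.2.1.2.2 hc₀.1 (mazurMainConjectureAt_offLocus_nonsplit W₀ p hc₀ hoff hns)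
  exact ⟨n, k, hlam, halg, Nat.le_succ_of_le (hkN hns)⟩

end Summit.BirchSwinnertonDyer.BirchSwinnertonDyer.Cruxes.MazurMCOnCellB.Deepmember
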